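/-
Copyright (c) 2026. All rights reserved.
Released under Apache 2.0 license as described in the file LICENSE.
Authors: abc-iut cell, prover seat abc-iut-w5-d096 (gen 8; row «PUNCTURED-HIGHER-GENUS-IDRIGID», part 4: the
Riemann-sphere transport `ℂ ∖ F ≅ ℙ¹ ∖ (F ∪ {∞})` — `ℂ ∖ F` is OF FINITE TYPE — and the cusp route at `ℂ ∖ F` with
ZERO hypotheses).
-/
import Literature.AnabelianGeometry.AbsoluteAnabelian.ArchimedeanHolFieldFunctorGeometricPSLPuncturedGenuineZeroResidual
import Literature.AlgebraicTopology.FundamentalGroup.PuncturedSurfacesNonabelianPi1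
import Literature.Geometry.Kaehler.RiemannSphere
import HarnessLib

/-!
# `ℂ ∖ F` is a Riemann surface of finite type (`≅ ℙ¹ ∖ (F ∪ {∞})`); (FC) and [AbsTopIII] Prop 4.2 (i) / Cor 4.5
# at `ℂ ∖ F` by the cusp route with ZERO hypotheses (PROOF-ONLY)

S. Mochizuki, *Topics in Absolute Anabelian Geometry III*, Cor 2.4 p.54 («a hyperbolic Aut-holomorphic space of
finite type associated to a Riemann surface `X` [which is, in turn, determined by a hyperbolic curve over `ℂ`]» — the
tree's `IsOfFiniteType`: biholomorphic to a compact Riemann surface minus finitely many points), proof of Prop 4.2 (i)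
p.106, Cor 4.5 pp.107–109 [MochizukiAbsTopIII2015]; H. M. Farkas, I. Kra, *Riemann Surfaces* (1992), §I.1.3 (the
Riemann sphere), IV.5.5–IV.5.6 [FarkasKra1992].

The genus-`0` hyperbolic curves over `ℂ` are the `ℂ ∖ F = ℙ¹ ∖ (F ∪ {∞})`, `F ⊆ ℂ` finite with `|F| ≥ 2` (the tree's
`HolRS.planeComplFinite F hF`, abc-iut-L4-t12).  abc-iut-w5-d038's (FC) theorem `cuspClasses_finite_ofOpens_compl_finite`
(row «FC-TOPOLOGICAL») is stated for punctured COMPACT surfaces `M ∖ S`; its author named «`ℂ ∖ F` needs the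
Riemann-sphere transport (tree `RiemannSphere.instIsManifold`) — next brick if wanted».  This file IS that brick, in the
form part 3 of this row consumes: a `FiniteTypeWitness` for `ℂ ∖ F`.

* `HolRS.isOfFiniteType_compl_finite` — **`ℂ ∖ F` is of finite type**: `X̄ := ℂ ∪ {∞}` (the tree's Riemann sphere,
  `Literature.Geometry.Kaehler.RiemannSphere`), `S := F ∪ {∞}`, and the biholomorphism `ℂ ∖ F ≅ ℙ¹ ∖ (F ∪ {∞})`
  induced by the holomorphic open embedding `ℂ ↪ ℂ ∪ {∞}` (`RiemannSphere.mdifferentiable_coe`, inverse = the finite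
  chart `z₁`, `RiemannSphere.mdifferentiableAt_coeChart`); `HolRS.isOfFiniteType_planeComplFinite`;
* `HolRS.not_compactSpace_planeComplFinite` — `ℂ ∖ F` is not compact (it is unbounded in `ℂ`);
* `HolRS.cuspClasses_of_cover_planeComplFinite` — **(FC) for the Möbius deck group of EVERY holomorphic covering
  `ℍ → ℂ ∖ F`** (part 3's `cuspClasses_of_cover_of_isOfFiniteType` at this witness; abc-iut-w5-d038's named next brick);
* ★★★ `HolRS.isIdRigid_EA_and_cor_4_5_full_mapsTo_planeComplFinite_of_cusps` (+ RC twin) — **[AbsTopIII] Prop 4.2 (i)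
  id-rigidity of «objects of `EA` mapping to `ℂ ∖ F`» and `Cor_4_5_full`, for every finite `F` with `2 ≤ |F|`, with ZERO
  hypotheses, by the UNIFORMISATION + CUSPS route** — every binder of part 3's theorem discharged in the kernel: finite type
  (this file), non-compactness (this file), `π₁(ℂ ∖ F) ≅ F_{|F|}` free of finite rank (the tree's
  `nonempty_mulEquiv_freeGroup_compl_finite`, Hatcher), non-abelian for `|F| ≥ 2` (abc-iut-L4-t7's
  `exists_mul_ne_mul_fundamentalGroup_compl_finite`).  This is a second, independent route to the cell that abc-iut-L4-t12's
  (H1′) route (`HolRS.isIdRigid_mapsTo_planeComplFinite`) closed first — and a kernel certificate that the binder set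
  {finite type, non-compact, `hπ`, `hab`} of the uniformisation column is jointly inhabited at a genuine curve.

Everything is a theorem; no definition, no instance, no named fact.  HONEST FRAMING: classical; MODEL side of [AbsTopIII]
§4 (model ≠ reconstruction ≠ node); nothing here bears on the disputed [IUTchIII] Cor. 3.12.
-/

set_option autoImplicit false

noncomputable section

namespace Literature.AnabelianGeometry.AbsoluteAnabelian

namespace HolRS

open scoped _root_.Manifold _root_.ContDiff _root_.Topology UpperHalfPlane MatrixGroups Matrix OnePoint
open _root_.MulAction _root_.Function _root_.CategoryTheory _root_.TopologicalSpace _root_.Set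
open Literature.IUT.HodgeTheaters (IsFreeOrSurface)
open Literature.Geometry.Kaehler Literature.Geometry.Kaehler.RiemannSphere
open Literature.AlgebraicTopology.FundamentalGroup (nonempty_mulEquiv_freeGroup_compl_finite
  exists_mul_ne_mul_fundamentalGroup_compl_finite)
open scoped Classical

/-! ### §1 `ℂ ∖ F ≅ ℙ¹ ∖ (F ∪ {∞})`: `ℂ ∖ F` is of finite type -/

section FiniteType

variable {F : Set ℂ} (hF : F.Finite)

/-- `↑z ∈ F ∪ {∞}` iff `z ∈ F`, for the puncture set of `ℙ¹` written as a `Finset`. [cite: FarkasKra1992, §I.1.3] -/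
private theorem coe_mem_punctures_iff {F₀ : Set ℂ} (hF₀ : F₀.Finite) (z : ℂ) :
    (z : OnePoint ℂ) ∈ insert (OnePoint.infty : OnePoint ℂ) (hF₀.toFinset.image ((↑) : ℂ → OnePoint ℂ)) ↔
      z ∈ F₀ := by
  rw [Finset.mem_insert, Finset.mem_image]
  constructor
  · rintro (h | ⟨w, hw, hwz⟩)
    · exact absurd h (OnePoint.coe_ne_infty z)
    · rw [OnePoint.coe_eq_coe] at hwz
      subst hwz
      exact hF₀.mem_toFinset.mp hw
  · intro hz
    exact Or.inr ⟨z, hF₀.mem_toFinset.mpr hz, rfl⟩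

/-- A point of `ℙ¹` outside `F ∪ {∞}` is finite: `q = ↑(z₁ q)` with `z₁ q ∉ F`. [cite: FarkasKra1992, §I.1.3] -/
private theorem eq_coe_coeChart_of_not_mem {F₀ : Set ℂ} (hF₀ : F₀.Finite) {q : OnePoint ℂ}
    (hq : q ∉ insert (OnePoint.infty : OnePoint ℂ) (hF₀.toFinset.image ((↑) : ℂ → OnePoint ℂ))) :
    ((coeChart q : ℂ) : OnePoint ℂ) = q ∧ coeChart q ∉ F₀ := by
  have hq' : q ≠ OnePoint.infty := fun h => hq (by rw [h]; exact Finset.mem_insert_self _ _)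
  obtain ⟨w, rfl⟩ := OnePoint.ne_infty_iff_exists.mp hq'
  refine ⟨by rw [coeChart_coe], fun hw => hq ?_⟩
  rw [coeChart_coe] at hw
  exact (coe_mem_punctures_iff hF₀ w).mpr hw

/-- **`ℂ ∖ F` is a Riemann surface OF FINITE TYPE** (`F ⊆ ℂ` finite): `ℂ ∖ F ≅ ℙ¹ ∖ (F ∪ {∞})`, the compactification
being the tree's Riemann sphere `ℂ ∪ {∞}` and the biholomorphism the restriction of the holomorphic open embedding
`ℂ ↪ ℂ ∪ {∞}` (inverse: the finite chart `z₁`).  This is the «[determined by] a hyperbolic curve over `ℂ`» clause of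
[AbsTopIII] Cor 2.4 at genus `0`. [cite: MochizukiAbsTopIII2015, Corollary 2.4 p.54] [cite: FarkasKra1992, §I.1.3] -/
theorem isOfFiniteType_compl_finite :
    IsOfFiniteType ((⟨Fᶜ, hF.isClosed.isOpen_compl⟩ : Opens ℂ) : Type) := by
  classical
  -- the puncture set `S = F ∪ {∞}` of the sphere and the open complement
  set S : Finset (OnePoint ℂ) :=
    insert (OnePoint.infty : OnePoint ℂ) (hF.toFinset.image ((↑) : ℂ → OnePoint ℂ)) with hSdef
  let V : Opens (OnePoint ℂ) := ⟨((S : Set (OnePoint ℂ)))ᶜ, S.finite_toSet.isClosed.isOpen_compl⟩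
  let U : Opens ℂ := ⟨Fᶜ, hF.isClosed.isOpen_compl⟩
  -- the homeomorphism `ℂ ∖ F ≃ₜ ℙ¹ ∖ (F ∪ {∞})`
  have hto : ∀ z : U, ((z : ℂ) : OnePoint ℂ) ∈ V := fun z => by
    change ((z : ℂ) : OnePoint ℂ) ∉ (S : Set (OnePoint ℂ))
    rw [Finset.mem_coe, hSdef, coe_mem_punctures_iff hF]
    exact z.2
  have hfrom : ∀ q : V, coeChart (q : OnePoint ℂ) ∈ U := fun q => by
    have hq : (q : OnePoint ℂ) ∉ S := fun h => q.2 (Finset.mem_coe.mpr h)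
    exact (eq_coe_coeChart_of_not_mem hF hq).2
  have hfrom' : ∀ q : V, ((coeChart (q : OnePoint ℂ) : ℂ) : OnePoint ℂ) = q := fun q => by
    have hq : (q : OnePoint ℂ) ∉ S := fun h => q.2 (Finset.mem_coe.mpr h)
    exact (eq_coe_coeChart_of_not_mem hF hq).1
  let e : U ≃ₜ V :=
    { toFun := fun z => ⟨((z : ℂ) : OnePoint ℂ), hto z⟩
      invFun := fun q => ⟨coeChart (q : OnePoint ℂ), hfrom q⟩
      left_inv := fun z => Subtype.ext (by simp)
      right_inv := fun q => Subtype.ext (hfrom' q)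
      continuous_toFun := (OnePoint.continuous_coe.comp continuous_subtype_val).subtype_mk _
      continuous_invFun := by
        refine Continuous.subtype_mk ?_ _
        refine coeChart.continuousOn.comp_continuous continuous_subtype_val fun q => ?_
        rw [coeChart_source]
        exact ⟨coeChart (q : OnePoint ℂ), hfrom' q⟩ }
  -- holomorphy of `e` and `e⁻¹`
  have hol : MDifferentiable 𝓘(ℂ, ℂ) 𝓘(ℂ, ℂ) e := by
    intro z
    rw [← mdifferentiableAt_subtypeVal_comp_iff]
    change MDifferentiableAt 𝓘(ℂ, ℂ) 𝓘(ℂ, ℂ) (fun z : U => (((z : ℂ) : OnePoint ℂ))) z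
    rw [mdifferentiableAt_subtype_iff (U := U) (f := ((↑) : ℂ → OnePoint ℂ))]
    exact mdifferentiable_coe _
  have hol_symm : MDifferentiable 𝓘(ℂ, ℂ) 𝓘(ℂ, ℂ) e.symm := by
    intro q
    rw [← mdifferentiableAt_subtypeVal_comp_iff]
    change MDifferentiableAt 𝓘(ℂ, ℂ) 𝓘(ℂ, ℂ) (fun q : V => coeChart (q : OnePoint ℂ)) q
    rw [mdifferentiableAt_subtype_iff (U := V) (f := (coeChart : OnePoint ℂ → ℂ))]
    rw [← hfrom' q]
    exact mdifferentiableAt_coeChart _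
  exact ⟨{ Xc := OnePoint ℂ, S := S, e := e, hol := hol, hol_symm := hol_symm }⟩

/-- **`planeComplFinite F hF` (abc-iut-L4-t12's `ℂ ∖ F` in `HolRS`) is of finite type.**
[cite: MochizukiAbsTopIII2015, Corollary 2.4 p.54] -/
theorem isOfFiniteType_planeComplFinite : IsOfFiniteType (planeComplFinite F hF).carrier :=
  isOfFiniteType_compl_finite hF

/-- **`ℂ ∖ F` is not compact** (`F` finite): it is unbounded in `ℂ`. [cite: FarkasKra1992, §I.1.3] -/
theorem not_compactSpace_planeComplFinite : ¬ CompactSpace (planeComplFinite F hF).carrier := by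
  intro h
  change CompactSpace ((⟨Fᶜ, hF.isClosed.isOpen_compl⟩ : Opens ℂ) : Type) at h
  have hK : IsCompact (Set.range (Subtype.val : ((⟨Fᶜ, hF.isClosed.isOpen_compl⟩ : Opens ℂ) : Type) → ℂ)) :=
    isCompact_range continuous_subtype_val
  have hr : Set.range (Subtype.val : ((⟨Fᶜ, hF.isClosed.isOpen_compl⟩ : Opens ℂ) : Type) → ℂ) = Fᶜ :=
    Subtype.range_coe
  rw [hr] at hK
  have hb : Bornology.IsBounded (Set.univ : Set ℂ) := by
    rw [← Set.compl_union_self F]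
    exact hK.isBounded.union hF.isBounded
  exact NormedSpace.unbounded_univ ℂ ℂ hb

end FiniteType

/-! ### §2 (FC) at `ℂ ∖ F` — abc-iut-w5-d038's «next brick» -/

section Cusps

variable {F : Set ℂ} (hF : F.Finite)

/-- **(FC) for the Möbius deck group of EVERY holomorphic covering `k : ℍ → ℂ ∖ F`** (`F` finite): finitely many
`Λ̄`-classes of cusps, in the binder shape of abc-iut-L4-t14's `…_of_cusps_hfinFree` — abc-iut-w5-d038's
`cuspClasses_finite_ofOpens_compl_finite` at `ℙ¹ ∖ (F ∪ {∞})` transported along §1's biholomorphism (part 3's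
`cuspClasses_of_cover_of_isOfFiniteType`). [cite: MochizukiAbsTopIII2015, Proposition 4.2 (i) proof p.106]
[cite: FarkasKra1992, IV.5.5–IV.5.6] -/
theorem cuspClasses_of_cover_planeComplFinite {k : ℍ → (planeComplFinite F hF).carrier} (hk : IsCoveringMap k)
    (dk : MDifferentiable 𝓘(ℂ, ℂ) 𝓘(ℂ, ℂ) k) (Λ : Subgroup PSL2R)
    (hΛ : ∀ q : PSL2R, q ∈ Λ ↔ ∀ τ : ℍ, k (q • τ) = k τ) :
    ∃ Fs : Finset (Fin 2 → ℝ), ∀ t : SL(2, ℝ),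
      QuotientGroup.mk' (Subgroup.center SL(2, ℝ)) t ∈ Λ → (t : Matrix (Fin 2) (Fin 2) ℝ).IsParabolic →
      ∀ v : Fin 2 → ℝ, v ≠ 0 → (∃ c : ℝ, (t : Matrix (Fin 2) (Fin 2) ℝ) *ᵥ v = c • v) →
      ∃ g : SL(2, ℝ), QuotientGroup.mk' (Subgroup.center SL(2, ℝ)) g ∈ Λ ∧ ∃ w ∈ Fs, ∃ c : ℝ,
        (g : Matrix (Fin 2) (Fin 2) ℝ) *ᵥ v = c • w :=
  cuspClasses_of_cover_of_isOfFiniteType (planeComplFinite F hF) (isOfFiniteType_planeComplFinite hF) hk dk Λ hΛ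

end Cusps

/-! ### §3 Prop 4.2 (i) / Cor 4.5 at `ℂ ∖ F` by the cusp route — ZERO hypotheses -/

section ZeroHypotheses

variable {F : Set ℂ} (hF : F.Finite) (h2 : 2 ≤ F.ncard)

include h2 in
/-- ★★★ **[AbsTopIII] Prop 4.2 (i) id-rigidity of «objects of `EA` mapping to `ℂ ∖ F`» and `Cor_4_5_full`, `F` finite with
`2 ≤ |F|`, with ZERO hypotheses, by the UNIFORMISATION + CUSPS route** (part 3's
`isIdRigid_EA_and_cor_4_5_full_mapsTo_of_isOfFiniteType` with every binder discharged: finite type and non-compactness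
§1, `π₁(ℂ ∖ F) ≅ F_{|F|}` (`nonempty_mulEquiv_freeGroup_compl_finite`) hence free of finite rank, non-abelian for
`|F| ≥ 2` (abc-iut-L4-t7's `exists_mul_ne_mul_fundamentalGroup_compl_finite`)).  Second route to the cell first closed by
abc-iut-L4-t12's (H1′) argument `HolRS.isIdRigid_mapsTo_planeComplFinite`.
[cite: MochizukiAbsTopIII2015, Proposition 4.2 (i) proof p.106] [cite: MochizukiAbsTopIII2015, Corollary 4.5 pp.107–109]
[cite: FarkasKra1992, IV.5.5–IV.5.6] -/
theorem isIdRigid_EA_and_cor_4_5_full_mapsTo_planeComplFinite_of_cusps :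
    IsIdRigid (geometricAutHolFieldFunctor fun Y : HolRS => Nonempty (Y ⟶ planeComplFinite F hF)).EA ∧
      AbsTopIII.Cor_4_5_full
        (archLogFrobeniusData (geometricAutHolFieldFunctor fun Y : HolRS => Nonempty (Y ⟶ planeComplFinite F hF)))
        (archTelecoreData (geometricAutHolFieldFunctor fun Y : HolRS => Nonempty (Y ⟶ planeComplFinite F hF))) := by
  obtain ⟨x⟩ : Nonempty (planeComplFinite F hF).carrier := inferInstance
  obtain ⟨ψ⟩ := nonempty_mulEquiv_freeGroup_compl_finite hF x
  have hπ : IsFreeOrSurface (FundamentalGroup (planeComplFinite F hF).carrier x) := Or.inl ⟨F.ncard, ⟨ψ⟩⟩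
  exact isIdRigid_EA_and_cor_4_5_full_mapsTo_of_isOfFiniteType (planeComplFinite F hF)
    (isOfFiniteType_planeComplFinite hF) (not_compactSpace_planeComplFinite hF) x hπ
    (exists_mul_ne_mul_fundamentalGroup_compl_finite hF h2 x)

include h2 in
/-- ★★★ **The same for print's RC-holomorphic morphisms** (Def 4.1 (iii) / Cor 2.3 (i)), ZERO hypotheses.
[cite: MochizukiAbsTopIII2015, Proposition 4.2 (i) proof p.106] [cite: MochizukiAbsTopIII2015, Corollary 4.5 pp.107–109] -/
theorem RC.isIdRigid_EA_and_cor_4_5_full_mapsTo_planeComplFinite_of_cusps :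
    IsIdRigid (geometricAutHolFieldFunctorRC fun Y : RC => Nonempty (Y ⟶ toRC.obj (planeComplFinite F hF))).EA ∧
      AbsTopIII.Cor_4_5_full
        (archLogFrobeniusData
          (geometricAutHolFieldFunctorRC fun Y : RC => Nonempty (Y ⟶ toRC.obj (planeComplFinite F hF))))
        (archTelecoreData
          (geometricAutHolFieldFunctorRC fun Y : RC => Nonempty (Y ⟶ toRC.obj (planeComplFinite F hF)))) := by
  obtain ⟨x⟩ : Nonempty (planeComplFinite F hF).carrier := inferInstance
  obtain ⟨ψ⟩ := nonempty_mulEquiv_freeGroup_compl_finite hF x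
  have hπ : IsFreeOrSurface (FundamentalGroup (planeComplFinite F hF).carrier x) := Or.inl ⟨F.ncard, ⟨ψ⟩⟩
  exact RC.isIdRigid_EA_and_cor_4_5_full_mapsTo_of_isOfFiniteType (planeComplFinite F hF)
    (isOfFiniteType_planeComplFinite hF) (not_compactSpace_planeComplFinite hF) x hπ
    (exists_mul_ne_mul_fundamentalGroup_compl_finite hF h2 x)

end ZeroHypotheses

end HolRS

end Literature.AnabelianGeometry.AbsoluteAnabelian

end
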